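import Mathlib
import HarnessLib
import Summits.Langlands.Langlands.Statement
import Summits.Langlands.Langlands.Theorems.BaseFieldAscentReciprocityTRCMStubAutToGalCMtoTR
import Literature.NumberTheory.Automorphic.CarayolCompatibilityOfLocalGlobalGLnProofs
import Literature.NumberTheory.GaloisRepresentations.WeilGroupFrobeniusPowers
import Literature.NumberTheory.GaloisRepresentations.WeilDeligneOfGaloisUnramifiedProofs
import Literature.NumberTheory.GaloisRepresentations.GaloisRepUnramifiedProofs
import Literature.NumberTheory.GaloisRepresentations.LocalGaloisGroupProofs

/-!
# Direction (A), CM ⇒ totally real, WEAK form, from the stub's hypothesis verbatim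
# (crux `ReciprocityTRCM`, stmt-Langlands-1093, line `registered`; `--supports` helper for the registered
# stub `stub_autToGalCMtoTR` = item stmt-Langlands-1063 `LiftDescend.AutToGalCMtoTR`)

Support file (closes nothing).  The registered stub (FULL form: a datum `R : ReciprocityData F` over the
totally real `F` to be produced, `Corresponds` at every finite place, pinned geometricity) is formally out
of reach today (lead memo: no transport of `LocalLanglandsDatum` / `LocalGlobalCompatibleAt` / the pinned
Fontaine datum along the split-place isomorphism `F_v ≃+* E_w`).  This file derives the WEAK form of its
conclusion from its hypothesis VERBATIM: `autToGal_weak_totallyReal_of_CM_of_autToGalCM` — for `2 ≤ n`,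
every L-algebraic cuspidal `π` over a totally real `F` has an IRREDUCIBLE `ρ : Γ_F → GL_n(ℚ̄_ℓ)`
Satake–Frobenius compatible with `π` almost everywhere — by feeding the CM reciprocity data `R_E`
through `Corresponds` and the converse matching "local–global compatibility at an unramified `w ∤ ℓ`
forces Satake–Frobenius compatibility" (every `Rec`, `2 ≤ n`) into the `R`-free patching theorem
`ReciprocityTRCM.exists_irreducible_satakeCompatible_of_CM` of the sibling `…StubAutToGalCMtoTR`
(Sorensen 2020, Thm. 1).

The converse matching is the tree's
`ReciprocityUpToIrreducibility.satakeFrobCompatibleAt_of_localGlobalCompatibleAt_away`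
(`…ReciprocityUpToIrreducibilityUnramifiedMatchingGLn`, lead c6 of crux stmt-Langlands-14328); its
import chain runs through the route module `Theses.IrreducibilityBySelfDuality`, so it is re-derived
here, self-contained, as PRIVATE copies (`-- adapted from …` comments): the automorphic side is the
Literature theorem `LocalLanglandsDatum.recGL_unramified_of_hasSatakeParamAt`
(`CarayolCompatibilityOfLocalGlobalGLnProofs`: every Frobenius-semisimple representative of
`rec_w(P_w)` is unramified with the Satake characteristic polynomial, `2 ≤ n`, every datum), the
Galois side is the rank-`n` Weil–Deligne bridge of `…ReciprocityUpToIrreducibilityWeilDeligneBridge`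
(Grothendieck–Deligne recipe with `N = 0`, transport along `ι`, `res(Φ⁻¹)` an arithmetic Frobenius,
`char(M⁻¹)` from `char(M)`).  Conditional on the two UNDISCHARGED named facts
`ArthurClozel1989_strongLifting_cuspidal`, `ArthurClozel1989_strongLifting_archimedean` (explicit
hypotheses).  No definitions; standard axioms.

## References
* C. M. Sorensen, *A patching lemma*, LMS Lecture Note Ser. 457 (2020), §1, Thm. 1. [Sorensen2020]
* M. Harris, K.-W. Lan, R. Taylor, J. Thorne, Res. Math. Sci. 3:37 (2016), proof of Cor. 7.14 (p. 232).
  [HarrisLanTaylorThorneRMS2016]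
* J. Arthur, L. Clozel, Ann. of Math. Stud. 120 (1989), Ch. 3, Thm. 4.2 (a), Thm. 5.1. [ArthurClozelAMS120]
* M. Harris, R. Taylor, Ann. of Math. Stud. 151 (2001), Thm. A (ii), (v). [HarrisTaylorAMS2001]
* J. Tate, *Number theoretic background*, Corvallis 1979, (4.1.6)–(4.2.1). [TateCorvallis1979]
* J. Neukirch, *Algebraic Number Theory* (1999), Ch. II §9 Prop. (9.6). [NeukirchANT1999]
* J.-P. Serre, *Abelian ℓ-adic representations* (1968), Ch. I §2.1. [SerreAbelianLadic1968]
* K. Buzzard, T. Gee, LMS Lecture Note Ser. 414 (2014), Conj. 3.2.1–3.2.2. [BuzzardGeeLMS2014]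
-/

noncomputable section

set_option linter.dupNamespace false -- project-wide option; `Summit.Langlands.Langlands` is the mandated namespace

open scoped MatrixGroups Matrix NumberField Classical Polynomial
open Filter IsDedekindDomain Field NumberField Polynomial
open Literature.NumberTheory.Automorphic Literature.NumberTheory.GaloisRepresentations
open Summit.Langlands

namespace Summit.Langlands.Langlands.Theorems.ReciprocityTRCM

/-! ### Linear algebra: the characteristic polynomial of an inverse matrix -/

section CharpolyInv

/-- `reverse` is multiplicative on multiset products (over a field). [folklore] -/
private theorem reverse_multiset_prod_trcm {L : Type*} [Field L] (s : Multiset L[X]) :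
    s.prod.reverse = (s.map reverse).prod := by
  -- adapted from `PicardMuOrdinaryMuOrdinaryFamilyRTDictionary.reverse_multiset_prod`
  induction s using Multiset.induction_on with
  | empty => simpa using reverse_C (1 : L)
  | cons a s ih => simp [reverse_mul_of_domain, ih]

/-- `reverse (X - c) = 1 - c X`. [folklore] -/
private theorem reverse_X_sub_C_trcm {L : Type*} [Field L] (c : L) :
    (X - C c : L[X]).reverse = 1 - C c * X := by
  -- adapted from `PicardMuOrdinaryMuOrdinaryFamilyRTDictionary.reverse_X_sub_C`
  rw [sub_eq_add_neg, ← C_neg, reverse_add_C, natDegree_X]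
  have h1 : (1 : L[X]).reverse = 1 := by simpa using reverse_C (1 : L)
  have : (X : L[X]).reverse = 1 := by simpa [h1] using reverse_mul_X (1 : L[X])
  rw [this, C_neg]; ring

/-- **Characteristic polynomial of the inverse.**  If an invertible matrix `M` over a field has
`charpoly M = ∏_{c ∈ s} (X - c)`, then `charpoly M⁻¹ = ∏_{c ∈ s} (X - c⁻¹)` (Mathlib's
`Matrix.charpoly_inv`, `reverse (X - c) = -c (X - c⁻¹)` for `c ≠ 0`, `det M = ∏ c`). [folklore] -/
private theorem charpoly_inv_of_charpoly_eq_prod_trcm {L : Type*} [Field L] {m : Type*} [Fintype m]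
    [DecidableEq m] {M : Matrix m m L} (hM : IsUnit M) {s : Multiset L}
    (h : M.charpoly = (s.map fun c => X - C c).prod) :
    M⁻¹.charpoly = (s.map fun c => X - C c⁻¹).prod := by
  -- adapted from `PicardMuOrdinaryMuOrdinaryFamilyRTDictionary.charpoly_inv_of_charpoly_eq_prod`
  have hcard : Multiset.card s = Fintype.card m := by
    have := congrArg natDegree h
    rwa [Matrix.charpoly_natDegree_eq_dim, natDegree_multiset_prod_X_sub_C_eq_card, eq_comm] at this
  have hdet : M.det = s.prod := by
    rw [Matrix.det_eq_sign_charpoly_coeff, h, coeff_zero_eq_eval_zero, eval_multiset_prod,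
      Multiset.map_map]
    simp only [Function.comp_def, eval_sub, eval_X, eval_C, zero_sub]
    rw [Multiset.prod_map_neg, hcard, ← mul_assoc, ← pow_add, ← two_mul, pow_mul]
    simp
  have hdet0 : M.det ≠ 0 := ((Matrix.isUnit_iff_isUnit_det M).mp hM).ne_zero
  have hs0 : ∀ c ∈ s, c ≠ 0 := fun c hc h0 => hdet0 (hdet ▸ Multiset.prod_eq_zero (h0 ▸ hc))
  rw [Matrix.charpoly_inv M hM, ← Matrix.reverse_charpoly, h, reverse_multiset_prod_trcm,
    Multiset.map_map]
  have h1 : (s.map (reverse ∘ fun c => X - C c)) = s.map (fun c => C (-c) * (X - C c⁻¹)) := by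
    refine Multiset.map_congr rfl fun c hc => ?_
    simp only [Function.comp_def, reverse_X_sub_C_trcm]
    rw [C_neg, neg_mul, mul_sub, ← C_mul, mul_inv_cancel₀ (hs0 c hc), C_1]
    ring
  have h2 : (s.map fun c => C (-c)).prod = C ((-1) ^ Fintype.card m * s.prod) := by
    rw [← hcard, ← Multiset.prod_map_neg, map_multiset_prod, Multiset.map_map]
    rfl
  have h3 : ((-1 : L[X]) ^ Fintype.card m * C (s.prod)⁻¹ * C ((-1) ^ Fintype.card m * s.prod)) =
      1 := by
    rw [← C_1, ← C_neg, ← C_pow, ← C_mul, ← C_mul]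
    congr 1
    rw [mul_comm ((-1 : L) ^ _) s.prod, ← mul_assoc, mul_assoc _ _ s.prod,
      inv_mul_cancel₀ (hdet ▸ hdet0), mul_one, ← pow_add, ← two_mul, pow_mul]
    simp
  rw [h1, Multiset.prod_map_mul, Ring.inverse_eq_inv', hdet, h2, ← mul_assoc, h3, one_mul]

end CharpolyInv

/-! ### The Grothendieck–Deligne recipe with `N = 0`, and transport along an injective `ι` -/

section LocalRecipe

variable {L : Type*} [Field L] [ValuativeRel L] [TopologicalSpace L] [IsNonarchimedeanLocalField L]
  {E : Type*} [Field E] [CharZero E] {n : ℕ}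

/-- **The Grothendieck–Deligne recipe with `N = 0` returns `ρW` itself**: if `r = (r.ρ, N)` is
attached to `ρW : W_L → GL_n(E)` by `IsWeilDeligneOfLadic` and `r.N = 0`, then `[r.ρ(w)] = ρW(w)` for
every `w ∈ W_L` (`w = Φ^{-deg w} · (Φ^{deg w} w)` with `Φ^{deg w} w ∈ I_L`, `exp 0 = 1`).
[cite: TateCorvallis1979, (4.2.1)] -/
private theorem toMatrix'_eq_of_isWeilDeligneOfLadic_of_N_eq_zero_trcm
    {ρW : WeilGroup L →* GL (Fin n) E} {r : WeilDeligneRep L E (Fin n → E)}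
    (h : IsWeilDeligneOfLadic ρW r) (hN : r.N = 0) (w : WeilGroup L) :
    LinearMap.toMatrix' (r.ρ w) = ((ρW w : GL (Fin n) E) : Matrix (Fin n) (Fin n) E) := by
  -- adapted from `ReciprocityUpToIrreducibility.toMatrix'_eq_of_isWeilDeligneOfLadic_of_N_eq_zero_wdBridge`
  obtain ⟨t, U, Φ, -, -, hΦ, -, -, h3⟩ := h
  have hmem : Φ ^ (WeilGroup.deg w) * w ∈ WeilGroup.inertia L := WeilGroup.zpow_deg_mul_mem_inertia hΦ w
  have key := h3 (-WeilGroup.deg w) ⟨Φ ^ (WeilGroup.deg w) * w, hmem⟩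
  have hw : Φ ^ (-WeilGroup.deg w) * (Φ ^ (WeilGroup.deg w) * w) = w := by
    rw [← mul_assoc, zpow_neg, inv_mul_cancel, one_mul]
  simp only [hw, hN, map_zero, smul_zero, neg_zero, IsNilpotent.exp_zero, mul_one] at key
  exact key

/-- **The Grothendieck–Deligne recipe supplies a geometric Frobenius**: `IsWeilDeligneOfLadic ρW r`
records some `Φ ∈ W_L` with `deg Φ = -1`. [cite: TateCorvallis1979, (4.2.1)] -/
private theorem exists_deg_eq_neg_one_of_isWeilDeligneOfLadic_trcm {ρW : WeilGroup L →* GL (Fin n) E}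
    {r : WeilDeligneRep L E (Fin n → E)} (h : IsWeilDeligneOfLadic ρW r) :
    ∃ Φ : WeilGroup L, WeilGroup.deg Φ = -1 := by
  -- adapted from `ReciprocityUpToIrreducibility.exists_deg_eq_neg_one_of_isWeilDeligneOfLadic_wdBridge`
  obtain ⟨-, -, Φ, -, -, hΦ, -⟩ := h
  exact ⟨Φ, hΦ⟩

variable {C : Type*} [Field C] [CharZero C]

/-- **Transport along an injective `ι` reflects `N = 0`** (`Matrix.map_injective`). [folklore] -/
private theorem N_eq_zero_of_isTransportAlong_trcm (ι : E →+* C) {r : WeilDeligneRep L E (Fin n → E)}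
    {r' : WeilDeligneRep L C (Fin n → C)} (hT : r.IsTransportAlong ι r') (hN : r'.N = 0) :
    r.N = 0 := by
  -- adapted from `ReciprocityUpToIrreducibility.N_eq_zero_of_isTransportAlong_wdBridge`
  have h := hT.2
  rw [hN, map_zero] at h
  have h' : (LinearMap.toMatrix' r.N).map ι = (0 : Matrix (Fin n) (Fin n) E).map ι := by
    rw [← h, Matrix.map_zero _ (map_zero ι)]
  exact (LinearEquiv.map_eq_zero_iff LinearMap.toMatrix').mp (Matrix.map_injective ι.injective h')

/-- **Transport along an injective `ι` reflects unramifiedness** (`Matrix.map_injective`). [folklore] -/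
private theorem isUnramifiedRep_of_isTransportAlong_trcm (ι : E →+* C)
    {r : WeilDeligneRep L E (Fin n → E)} {r' : WeilDeligneRep L C (Fin n → C)}
    (hT : r.IsTransportAlong ι r') (hur : WeilGroup.IsUnramifiedRep r'.ρ) :
    WeilGroup.IsUnramifiedRep r.ρ := by
  -- adapted from `ReciprocityUpToIrreducibility.isUnramifiedRep_of_isTransportAlong_wdBridge`
  intro u hu
  have h := hT.1 u
  rw [hur u hu, LinearMap.toMatrix'_one] at h
  have h' : (LinearMap.toMatrix' (r.ρ u)).map ι = (1 : Matrix (Fin n) (Fin n) E).map ι := by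
    rw [← h, Matrix.map_one _ (map_zero ι) (map_one ι)]
  have h'' := Matrix.map_injective ι.injective h'
  rw [← LinearMap.toMatrix'_one] at h''
  exact LinearMap.toMatrix'.injective h''

end LocalRecipe

/-! ### Rank `n`: from unramified Weil–Deligne data back to `ρ`, and the converse matching away from `ℓ` -/

section Away

variable {K : Type} [Field K] [NumberField K] {ℓ : ℕ} [Fact ℓ.Prime] {n : ℕ}

/-- **From the Weil–Deligne data at `v` back to `ρ` (rank `n`).**  Let `ρ : Γ_K → GL_n(ℚ̄_ℓ)`, `v` a
finite place, `rv` attached to `ρ|_{W_{K_v}}` by the Grothendieck–Deligne recipe and `rℂ` its transport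
along `ι`.  If `rℂ.N = 0`, `rℂ.ρ` is unramified and `char(rℂ.ρ(Φ)) = ∏_{a ∈ α} (X - a)` at every
geometric Frobenius `Φ`, then `ρ` is unramified at `v` and every arithmetic Frobenius at `v` has
characteristic polynomial `arithFrobPolyOfSatake ι q_v 1 α = ∏_{a ∈ α} (X - ι⁻¹(a⁻¹))`.
[cite: TateCorvallis1979, (4.2.1)] [cite: NeukirchANT1999, Ch. II §9 Prop. (9.6)]
[cite: SerreAbelianLadic1968, Ch. I §2.1] -/
private theorem isUnramifiedAt_and_hasFrobCharpolyAt_of_weilDeligne_trcm (ι : PadicAlgCl ℓ ≃+* ℂ)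
    (ρ : FramedGaloisRep K (PadicAlgCl ℓ) n) (v : HeightOneSpectrum (𝓞 K))
    {rv : WeilDeligneRep (v.adicCompletion K) (PadicAlgCl ℓ) (Fin n → PadicAlgCl ℓ)}
    {rℂ : WeilDeligneRep (v.adicCompletion K) ℂ (Fin n → ℂ)} {α : Multiset ℂ}
    (hWD : IsWeilDeligneOfLadic (ρ.toLocal v).toWeilGroupHom rv)
    (hT : rv.IsTransportAlong (ι : PadicAlgCl ℓ →+* ℂ) rℂ)
    (hN : rℂ.N = 0) (hur : WeilGroup.IsUnramifiedRep rℂ.ρ)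
    (hch : ∀ Φ : WeilGroup (v.adicCompletion K), WeilGroup.deg Φ = -1 →
      (rℂ.ρ Φ).charpoly = (α.map fun a => X - C a).prod) :
    ρ.IsUnramifiedAt v ∧ ρ.HasFrobCharpolyAt v (arithFrobPolyOfSatake ι v.residueCard 1 α) := by
  -- adapted from `ReciprocityUpToIrreducibility.isUnramifiedAt_and_hasFrobCharpolyAt_of_weilDeligne_wdBridge`
  classical
  have hιinj : Function.Injective (ι : PadicAlgCl ℓ →+* ℂ) := (ι : PadicAlgCl ℓ →+* ℂ).injective
  -- (a) `rv.N = 0` and `rv.ρ` is unramified (transport along the injective `ι`)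
  have hNv : rv.N = 0 := N_eq_zero_of_isTransportAlong_trcm _ hT hN
  have hurv : WeilGroup.IsUnramifiedRep rv.ρ := isUnramifiedRep_of_isTransportAlong_trcm _ hT hur
  -- (b) the recipe with `N = 0` returns `ρ|_{W_{K_v}}` itself
  have hρWeq : ∀ u : WeilGroup (v.adicCompletion K), LinearMap.toMatrix' (rv.ρ u) =
      (((ρ.toLocal v).toWeilGroupHom u : GL (Fin n) (PadicAlgCl ℓ)) :
        Matrix (Fin n) (Fin n) (PadicAlgCl ℓ)) :=
    toMatrix'_eq_of_isWeilDeligneOfLadic_of_N_eq_zero_trcm hWD hNv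
  -- (c) `ρ|_{Γ_{K_v}}` is trivial on inertia: `ρ` is unramified at `v`
  have hloc : ∀ σ ∈ absInertia (v.adicCompletion K), ρ.toLocal v σ = 1 := by
    intro σ hσ
    set u : WeilGroup (v.adicCompletion K) :=
      ⟨σ, absInertia_le_weilSubgroup (v.adicCompletion K) hσ⟩ with hu_def
    have hu : u ∈ WeilGroup.inertia (v.adicCompletion K) := by
      rw [WeilGroup.mem_inertia_iff]; exact hσ
    have h : (ρ.toLocal v).toWeilGroupHom u = 1 := by
      refine Units.ext ?_
      rw [← hρWeq u, hurv u hu, LinearMap.toMatrix'_one, Units.val_one]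
    rwa [FramedRep.toWeilGroupHom_apply] at h
  have hunr' : ρ.toGaloisRep.IsUnramifiedAt v := by
    refine (GaloisRep.isUnramifiedAt_iff_toLocal_holds v ρ.toGaloisRep).mpr fun σ hσ => ?_
    have h3 : FramedRep.toRepresentation ρ (absGaloisRestrict K (v.adicCompletion K) σ) = 1 := by
      rw [FramedRep.toRepresentation_apply_eq_one_iff]
      exact hloc σ hσ
    exact h3
  have hunr : ρ.IsUnramifiedAt v := (ρ.isUnramifiedAt_toGaloisRep_iff v).mp hunr'
  refine ⟨hunr, ?_⟩
  -- (d) a geometric Frobenius `Φ` (from the recipe) and the arithmetic Frobenius `res(Φ⁻¹)` at `𝔓₀`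
  obtain ⟨Φ, hΦ⟩ := exists_deg_eq_neg_one_of_isWeilDeligneOfLadic_trcm hWD
  set τ : absoluteGaloisGroup (v.adicCompletion K) := WeilGroup.toAbsGalois (v.adicCompletion K) Φ
    with hτ
  have hτ' : IsFrobPow τ (-1) := by
    simpa [hΦ] using WeilGroup.isFrobPow_deg IsFrobPow.mul_holds Φ
  have hτinv : IsAbsArithFrob τ⁻¹ := by
    have h := hτ'.inv
    rw [neg_neg] at h
    exact isFrobPow_one_iff_isAbsArithFrob_holds.mp h
  have hq : IsNonarchimedeanLocalField.residueFieldCard (v.adicCompletion K) =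
      Nat.card (𝓞 K ⧸ v.asIdeal) :=
    (residueFieldCard_adicCompletion_eq K v).trans (HeightOneSpectrum.residueCard_eq_card_quotient v)
  set σ : absoluteGaloisGroup K := absGaloisRestrict K (v.adicCompletion K) τ⁻¹ with hσ_def
  have hσ : IsArithFrobAt (𝓞 K) σ (adicCompletionPrime K v) :=
    (isArithFrobAt_absGaloisRestrict_adicCompletionPrime_iff K v hq τ⁻¹).mpr hτinv
  -- (e) the matrices: `[rℂ.ρ Φ] = ι [ρ(Φ)]` and `ρ(σ) = ρ(Φ)⁻¹`
  set ME : Matrix (Fin n) (Fin n) (PadicAlgCl ℓ) :=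
    (((ρ.toLocal v).toWeilGroupHom Φ : GL (Fin n) (PadicAlgCl ℓ)) :
      Matrix (Fin n) (Fin n) (PadicAlgCl ℓ)) with hME
  have hM : LinearMap.toMatrix' (rℂ.ρ Φ) = ME.map (ι : PadicAlgCl ℓ →+* ℂ) := by
    rw [hT.1 Φ, hρWeq Φ]
  have hrσ : ((ρ σ : GL (Fin n) (PadicAlgCl ℓ)) : Matrix (Fin n) (Fin n) (PadicAlgCl ℓ)) = ME⁻¹ := by
    have h1 : ρ σ = ((ρ.toLocal v).toWeilGroupHom Φ)⁻¹ := by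
      rw [hσ_def, ← FramedGaloisRep.toLocal_apply, map_inv, FramedRep.toWeilGroupHom_apply]
    rw [h1, Matrix.coe_units_inv]
  -- `char(ME) = ∏ (X - ι⁻¹ a)` since after `ι` it is `char(rℂ.ρ Φ) = ∏ (X - a)`
  have hchME : ME.charpoly = ((α.map fun a => ι.symm a).map fun c => X - C c).prod := by
    rw [Multiset.map_map]
    apply Polynomial.map_injective (ι : PadicAlgCl ℓ →+* ℂ) hιinj
    rw [← Matrix.charpoly_map, ← hM, ← charpoly_eq_charpoly_toMatrix', hch Φ hΦ,
      Polynomial.map_multiset_prod, Multiset.map_map]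
    refine congrArg _ (Multiset.map_congr rfl fun a _ => ?_)
    simp only [Function.comp_apply, Polynomial.map_sub, Polynomial.map_X, Polynomial.map_C,
      RingHom.coe_coe, RingEquiv.apply_symm_apply]
  -- `char(ρ σ) = char(ME⁻¹) = ∏ (X - (ι⁻¹ a)⁻¹) = arithFrobPolyOfSatake ι q_v 1 α`
  have hcharE : FramedRep.charpoly ρ σ = arithFrobPolyOfSatake ι v.residueCard 1 α := by
    unfold FramedRep.charpoly
    rw [hrσ, charpoly_inv_of_charpoly_eq_prod_trcm (Units.isUnit _) hchME, arithFrobPolyOfSatake_one,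
      Multiset.map_map]
    refine congrArg _ (Multiset.map_congr rfl fun a _ => ?_)
    simp only [Function.comp_apply, map_inv₀]
  -- (f) all Frobenii at all primes above `v`
  have hP := hunr'.hasFrobCharpolyAt_charpoly (adicCompletionPrime_mem_primesAbove K v) hσ
  have hP' := (FramedGaloisRep.hasFrobCharpolyAt_toGaloisRep_iff v _ ρ).mp hP
  have hPeq : FramedRep.charpoly ρ σ = (ρ.toGaloisRep σ).charpoly :=
    hP' _ (adicCompletionPrime_mem_primesAbove K v) σ hσ
  rw [← hcharE, hPeq]
  exact hP'

/-- **`GL_n`, `2 ≤ n`, `v ∤ ℓ`, EVERY `Rec`: local–global compatibility at an unramified place of `π`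
forces Satake–Frobenius compatibility.**  The Frobenius-semisimplification of the transported
Weil–Deligne representation `rℂ` lies in `rec_v(π_v)`, hence is unramified with `N = 0` and the Satake
characteristic polynomial (`LocalLanglandsDatum.recGL_unramified_of_hasSatakeParamAt`, Carayol's local
deduction in rank `n`, every local Langlands datum); these pass to `rℂ` (a commuting nilpotent
perturbation does not change the characteristic polynomial), and the rank-`n` Weil–Deligne bridge
returns the Satake clause. [cite: HarrisTaylorAMS2001, Thm. A (ii), (v)]
[cite: TateCorvallis1979, (4.1.6)–(4.2.1)] [cite: BuzzardGeeLMS2014, Conj. 3.2.1–3.2.2] -/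
private theorem satakeFrobCompatibleAt_of_localGlobalCompatibleAt_away_trcm (hn : 1 < n)
    {hcpt : isCompact_glFiniteIntegralLevel n K} (Rec : ReciprocityData K) (ι : PadicAlgCl ℓ ≃+* ℂ)
    (π : CuspidalAutomorphicRepData n K hcpt) (ρ : FramedGaloisRep K (PadicAlgCl ℓ) n)
    {v : HeightOneSpectrum (𝓞 K)} (hv : ((ℓ : ℕ) : 𝓞 K) ∉ v.asIdeal)
    (hπ : π.1.IsUnramifiedAt v) (hLG : LocalGlobalCompatibleAt Rec ι π.1 ρ v) :
    SatakeFrobCompatibleAt ι π.1 ρ v := by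
  -- adapted from `ReciprocityUpToIrreducibility.satakeFrobCompatibleAt_of_localGlobalCompatibleAt_away`
  obtain ⟨α, hα⟩ := hπ
  obtain ⟨πv, rv, rℂ, hloc, hWD, -, hT, r', hr', hc⟩ := hLG
  obtain ⟨hN', hρ', hchar'⟩ :=
    (Rec.llc v).recGL_unramified_of_hasSatakeParamAt hn hcpt π v α hα πv hloc r' hr'.isFrobSemisimple
      hc.symm
  have hN : rℂ.N = 0 := hr'.1.symm.trans hN'
  have hur : WeilGroup.IsUnramifiedRep rℂ.ρ := fun u hu => (hr'.2.1 u hu).symm.trans (hρ' u hu)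
  have hch : ∀ Φ : WeilGroup (v.adicCompletion K), WeilGroup.deg Φ = -1 →
      (rℂ.ρ Φ).charpoly = (α.map fun a => X - C a).prod := fun Φ hΦ => by
    obtain ⟨-, m, hm, hcm, hsum⟩ := hr'.2.2 Φ
    rw [hsum, LinearMap.charpoly_add_eq_of_isNilpotent_of_commute hm hcm, hchar' Φ hΦ]
  obtain ⟨hunr, hcp⟩ :=
    isUnramifiedAt_and_hasFrobCharpolyAt_of_weilDeligne_trcm ι ρ v (hWD hv) hT hN hur hch
  exact ⟨α, hα, hunr, hcp⟩

end Away

section Weak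

/-- **(A) over all CM fields ⇒ WEAK (A) over all totally real fields, `n ≥ 2`** — the part of the
registered stub `stub_autToGalCMtoTR` (item stmt-Langlands-1063) the tree carries today, from the stub's
hypothesis VERBATIM and the two named facts of Arthur–Clozel as hypotheses
(`ArthurClozel1989_strongLifting_cuspidal`, `ArthurClozel1989_strongLifting_archimedean`): over every totally real
`F`, `2 ≤ n`, every L-algebraic cuspidal `π`, `ℓ`, `ι`, an IRREDUCIBLE `ρ : Γ_F → GL_n(ℚ̄_ℓ)` Satake–Frobenius
compatible with `π` a.e.  The CM data `R_E` are consumed only through `Corresponds` and the converse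
matching at the unramified places away from `ℓ` (every `Rec`, `2 ≤ n`), which supply the `R`-free CM
input of `exists_irreducible_satakeCompatible_of_CM`.  NOT obtained (the stub's residue):
`R : ReciprocityData F`, `IsGeometricFramed R ρ`, local–global compatibility at every place.
[cite: Sorensen2020, Thm. 1] [cite: HarrisLanTaylorThorneRMS2016, proof of Cor. 7.14 (p. 232)]
[cite: ArthurClozelAMS120, Ch. 3 Thm. 4.2 (a) and Thm. 5.1] -/
theorem autToGal_weak_totallyReal_of_CM_of_autToGalCM : Literature.NumberTheory.Automorphic.ArthurClozel1989_strongLifting_cuspidal → Literature.NumberTheory.Automorphic.ArthurClozel1989_strongLifting_archimedean → (∀ (F : Type) [Field F] [NumberField F], NumberField.IsCMField F → ∃ R : ReciprocityData F, ∀ n : ℕ, 0 < n → ∀ hcpt : Literature.NumberTheory.Automorphic.isCompact_glFiniteIntegralLevel n F, AutomorphicToGalois n R hcpt) → ∀ (F : Type) [Field F] [NumberField F], NumberField.IsTotallyReal F → ∀ n : ℕ, 1 < n → ∀ (hcpt : Literature.NumberTheory.Automorphic.isCompact_glFiniteIntegralLevel n F) (π : Literature.NumberTheory.Automorphic.CuspidalAutomorphicRepData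 n F hcpt), π.1.IsLAlgebraic → ∀ (ℓ : ℕ) [Fact ℓ.Prime] (ι : PadicAlgCl ℓ ≃+* ℂ), ∃ ρ : Literature.NumberTheory.GaloisRepresentations.FramedGaloisRep F (PadicAlgCl ℓ) n, ρ.toGaloisRep.IsIrreducible ∧ ∀ᶠ v : IsDedekindDomain.HeightOneSpectrum (NumberField.RingOfIntegers F) in cofinite, SatakeFrobCompatibleAt ι π.1 ρ v := by
  intro hBC harch hA F _ _ hF n hn hcpt π hπ ℓ _ ι
  have hA' : ∀ (E : Type) [Field E] [NumberField E], IsCMField E →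
      ∀ (hE : isCompact_glFiniteIntegralLevel n E) (P : CuspidalAutomorphicRepData n E hE),
        P.1.IsLAlgebraic → ∃ ρ : FramedGaloisRep E (PadicAlgCl ℓ) n, ρ.toGaloisRep.IsIrreducible ∧
          (∀ᶠ w : HeightOneSpectrum (𝓞 E) in cofinite, SatakeFrobCompatibleAt ι P.1 ρ w) ∧
          ∀ w : HeightOneSpectrum (𝓞 E), ((ℓ : ℕ) : 𝓞 E) ∉ w.asIdeal → P.1.IsUnramifiedAt w →
            SatakeFrobCompatibleAt ι P.1 ρ w := by
    intro E _ _ hEcm hE P hP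
    obtain ⟨R, hR⟩ := hA E hEcm
    obtain ⟨ρ, hirr, -, hcorr, -⟩ := hR n (lt_trans zero_lt_one hn) hE P hP ℓ ι
    exact ⟨ρ, hirr, hcorr.1, fun w hw hPw ↦
      satakeFrobCompatibleAt_of_localGlobalCompatibleAt_away_trcm hn R ι P ρ hw hPw (hcorr.2 w)⟩
  obtain ⟨r, hirr, -, hae⟩ := exists_irreducible_satakeCompatible_of_CM hBC harch hA' hF π hπ
  exact ⟨r, hirr, hae⟩

end Weak

end Summit.Langlands.Langlands.Theorems.ReciprocityTRCM

end
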